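import Summits.Ventures.PercRepro.GenQSolidFacts

/-!
# PercRepro — the demand-free sets of type `t` whose complement has `t` points (night-4, gen 4)

At type `t` a spanning set `S` of the rank-`q` set `G` is demand-free iff `rk(G ∖ S) ≤ t − 1`.  Besides the levels
`< t` (`sum_card_Pc_le_DFq_of_lt`) the level `t` contributes the `t`-subsets `A ⊆ G` of rank `≤ t − 1` whose complement
spans.  This file counts them through the flats of rank `t − 1` — the row (R5b) of the type-`5` LP of record (sheet §55):

* `card_level_eq_card_compl`: the level-`t` spanning sets are the `t`-subsets with spanning complement (`A ↦ G ∖ A`);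
* `DFq_ge_levels_add_rank_le`: `DF_t ≥ #{|G ∖ S| < t} + #{A : |A| = t, rk A ≤ t − 1, G ∖ A spans}`;
* `card_rank_eq_spanning_ge`: `#{A : |A| = t, rk A = t − 1, G ∖ A spans} + (C(n, t) − i_t) ≥ #{A : |A| = t, rk A = t − 1}`
  (the non-spanning complements are exactly `C(n, t) − i_t`);
* `card_rank_eq_eq_sum_flats`: `#{A : |A| = t, rk A = t − 1} = Σ_{F ∈ flatsQ M (t−1)} #{A ⊆ F ∩ G : |A| = t, rk A = t − 1}`
  (each such `A` determines its flat `cl A`);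
* `DFq_ge_of_flats`: the four together — `DF_t + C(n, t) ≥ #{|G ∖ S| < t} + i_t + Σ_F #{A ⊆ F ∩ G : |A| = t, rk A = t − 1}`.

The per-flat lower bounds `#{A ⊆ F ∩ G : |A| = 5, rk A = 4} ≥ 37, 96, 209` for `|F ∩ G| = 8, 9, 10` (the constants `r₅(s)`
of the LP) are the plane-counting statement of sheet §55 (R5b), not in this file.  Imports `GenQSolidFacts`.
-/
namespace PercRepro.Night4

open Finset ThmH SixFour GenQ PerFlat Star

variable {α : Type*} [DecidableEq α] {M : Matroid α} [M.Finite]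

/-- The `t`-subsets of `G` with spanning complement. -/
noncomputable def coSpan (M : Matroid α) [M.Finite] (G : Finset α) (q t : ℕ) : Finset (Finset α) :=
  (G.powersetCard t).filter (fun A : Finset α => G \ A ∈ Rq M G q)

/-- Level `t` of `R_q(G)` is in bijection with `coSpan` (`S ↦ G ∖ S`). -/
theorem card_level_eq_card_compl (G : Finset α) (q t : ℕ) :
    ((Rq M G q).filter (fun S : Finset α => (G \ S).card = t)).card = (coSpan M G q t).card := by
  unfold coSpan
  refine Finset.card_bij' (fun S _ => G \ S) (fun A _ => G \ A) ?_ ?_ ?_ ?_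
  · intro S hS
    rw [Finset.mem_filter] at hS
    have hSG := (mem_Rq.1 hS.1).1
    rw [Finset.mem_filter, Finset.mem_powersetCard]
    refine ⟨⟨Finset.sdiff_subset, hS.2⟩, ?_⟩
    rw [Finset.sdiff_sdiff_eq_self hSG]
    exact hS.1
  · intro A hA
    rw [Finset.mem_filter, Finset.mem_powersetCard] at hA
    rw [Finset.mem_filter]
    refine ⟨hA.2, ?_⟩
    rw [Finset.sdiff_sdiff_eq_self hA.1.1]
    exact hA.1.2
  · intro S hS
    rw [Finset.mem_filter] at hS
    exact Finset.sdiff_sdiff_eq_self (mem_Rq.1 hS.1).1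
  · intro A hA
    rw [Finset.mem_filter, Finset.mem_powersetCard] at hA
    exact Finset.sdiff_sdiff_eq_self hA.1.1

/-- **`DF_t` is at least the levels `< t` plus the `t`-subsets of rank `≤ t − 1` with spanning complement.** -/
theorem DFq_ge_levels_add_rank_le (G : Finset α) (q t : ℕ) :
    ((Rq M G q).filter (fun S : Finset α => (G \ S).card < t)).card +
      ((coSpan M G q t).filter (fun A : Finset α => M.eRk (A : Set α) + 1 ≤ (t : ℕ∞))).card ≤ DFq M G q t := by
  unfold DFq
  have h1 : ((coSpan M G q t).filter (fun A : Finset α => M.eRk (A : Set α) + 1 ≤ (t : ℕ∞))).card =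
      ((Rq M G q).filter (fun S : Finset α => (G \ S).card = t ∧ M.eRk ((G \ S : Finset α) : Set α) + 1 ≤ (t : ℕ∞))).card := by
    unfold coSpan
    rw [Finset.filter_filter]
    symm
    refine Finset.card_bij' (fun S _ => G \ S) (fun A _ => G \ A) ?_ ?_ ?_ ?_
    · intro S hS
      rw [Finset.mem_filter] at hS
      have hSG := (mem_Rq.1 hS.1).1
      rw [Finset.mem_filter, Finset.mem_powersetCard]
      refine ⟨⟨Finset.sdiff_subset, hS.2.1⟩, ?_, hS.2.2⟩
      rw [Finset.sdiff_sdiff_eq_self hSG]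
      exact hS.1
    · intro A hA
      rw [Finset.mem_filter, Finset.mem_powersetCard] at hA
      rw [Finset.mem_filter]
      refine ⟨hA.2.1, ?_, ?_⟩
      · rw [Finset.sdiff_sdiff_eq_self hA.1.1]
        exact hA.1.2
      · rw [Finset.sdiff_sdiff_eq_self hA.1.1]
        exact hA.2.2
    · intro S hS
      rw [Finset.mem_filter] at hS
      exact Finset.sdiff_sdiff_eq_self (mem_Rq.1 hS.1).1
    · intro A hA
      rw [Finset.mem_filter, Finset.mem_powersetCard] at hA
      exact Finset.sdiff_sdiff_eq_self hA.1.1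
  rw [h1]
  have hdisj : Disjoint ((Rq M G q).filter (fun S : Finset α => (G \ S).card < t))
      ((Rq M G q).filter (fun S : Finset α => (G \ S).card = t ∧ M.eRk ((G \ S : Finset α) : Set α) + 1 ≤ (t : ℕ∞))) := by
    rw [Finset.disjoint_filter]
    intro S _ h1 h2
    omega
  rw [← Finset.card_union_of_disjoint hdisj]
  apply Finset.card_le_card
  intro S hS
  rw [Finset.mem_union, Finset.mem_filter, Finset.mem_filter] at hS
  rw [Finset.mem_filter]
  rcases hS with ⟨hS, hlt⟩ | ⟨hS, _, hr⟩
  · refine ⟨hS, ?_⟩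
    have h1 : M.eRk ((G \ S : Finset α) : Set α) ≤ ((G \ S).card : ℕ∞) := by
      have := M.eRk_le_encard ((G \ S : Finset α) : Set α)
      rwa [Set.encard_coe_eq_coe_finsetCard] at this
    have h2 : ((G \ S).card : ℕ∞) + 1 ≤ (t : ℕ∞) := by
      have : (G \ S).card + 1 ≤ t := hlt
      exact_mod_cast this
    calc M.eRk ((G \ S : Finset α) : Set α) + 1 ≤ ((G \ S).card : ℕ∞) + 1 := by gcongr
      _ ≤ (t : ℕ∞) := h2
  · exact ⟨hS, hr⟩

/-- The `t`-subsets of rank exactly `t − 1` with spanning complement are at least the rank-`(t − 1)` `t`-subsets minus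
the `t`-subsets with non-spanning complement, which number `C(n, t) − i_t`. -/
theorem card_rank_eq_spanning_ge (G : Finset α) (q t r : ℕ) :
    ((G.powersetCard t).filter (fun A : Finset α => M.eRk (A : Set α) = (r : ℕ∞))).card ≤
      ((coSpan M G q t).filter (fun A : Finset α => M.eRk (A : Set α) = (r : ℕ∞))).card +
        (G.card.choose t - (coSpan M G q t).card) := by
  have hsub : coSpan M G q t ⊆ G.powersetCard t := Finset.filter_subset _ _
  have hc : (coSpan M G q t).card ≤ G.card.choose t := by
    rw [← Finset.card_powersetCard]
    exact Finset.card_le_card hsub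
  -- the rank-`r` `t`-subsets split into those in `coSpan` and those outside
  have h1 : ((G.powersetCard t).filter (fun A : Finset α => M.eRk (A : Set α) = (r : ℕ∞))).card ≤
      ((coSpan M G q t).filter (fun A : Finset α => M.eRk (A : Set α) = (r : ℕ∞))).card +
        ((G.powersetCard t) \ coSpan M G q t).card := by
    have hsplit : (G.powersetCard t).filter (fun A : Finset α => M.eRk (A : Set α) = (r : ℕ∞)) ⊆
        (coSpan M G q t).filter (fun A : Finset α => M.eRk (A : Set α) = (r : ℕ∞)) ∪
          ((G.powersetCard t) \ coSpan M G q t) := by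
      intro A hA
      rw [Finset.mem_filter] at hA
      rw [Finset.mem_union, Finset.mem_filter, Finset.mem_sdiff]
      by_cases h : A ∈ coSpan M G q t
      · exact Or.inl ⟨h, hA.2⟩
      · exact Or.inr ⟨hA.1, h⟩
    exact (Finset.card_le_card hsplit).trans (Finset.card_union_le _ _)
  have h2 : ((G.powersetCard t) \ coSpan M G q t).card = G.card.choose t - (coSpan M G q t).card := by
    rw [Finset.card_sdiff_of_subset hsub, Finset.card_powersetCard]
  omega

/-- A `t`-subset of rank `r` lies in the rank-`r` flat `cl A`: the rank-`r` `t`-subsets of `G` are partitioned by the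
flats of rank `r`. -/
theorem card_rank_eq_eq_sum_flats {G : Finset α} (hG : G ⊆ gr M) (t r : ℕ) :
    ((G.powersetCard t).filter (fun A : Finset α => M.eRk (A : Set α) = (r : ℕ∞))).card =
      ∑ F ∈ flatsQ M r, (((F ∩ G).powersetCard t).filter (fun A : Finset α => M.eRk (A : Set α) = (r : ℕ∞))).card := by
  rw [Finset.card_eq_sum_card_fiberwise (s := (G.powersetCard t).filter (fun A : Finset α => M.eRk (A : Set α) = (r : ℕ∞)))
    (t := flatsQ M r) (f := fun A => clF M A) (fun A hA => by
      rw [Finset.mem_coe, Finset.mem_filter, Finset.mem_powersetCard] at hA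
      have hAE : (A : Set α) ⊆ M.E := by
        rw [← coe_gr M]
        exact Finset.coe_subset.2 (hA.1.1.trans hG)
      refine Finset.mem_coe.2 (mem_flatsQ.2 ⟨?_, ?_, ?_⟩)
      · intro x hx
        rw [← Finset.mem_coe, coe_clF] at hx
        have := M.closure_subset_ground _ hx
        rw [← coe_gr M] at this
        exact Finset.mem_coe.1 this
      · rw [coe_clF]
        exact M.isFlat_closure _
      · rw [coe_clF, M.eRk_closure_eq, hA.2])]
  apply Finset.sum_congr rfl
  intro F hF
  apply congrArg Finset.card
  ext A
  simp only [Finset.mem_filter, Finset.mem_powersetCard]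
  constructor
  · rintro ⟨⟨⟨hAG, hAc⟩, hAr⟩, hcl⟩
    refine ⟨⟨?_, hAc⟩, hAr⟩
    intro x hx
    rw [Finset.mem_inter]
    refine ⟨?_, hAG hx⟩
    rw [← hcl, ← Finset.mem_coe, coe_clF]
    have hxE : x ∈ M.E := by
      rw [← coe_gr M]
      exact Finset.mem_coe.2 (hG (hAG hx))
    exact M.mem_closure_of_mem' (Finset.mem_coe.2 hx) hxE
  · rintro ⟨⟨hAF, hAc⟩, hAr⟩
    have hAG : A ⊆ G := hAF.trans Finset.inter_subset_right
    refine ⟨⟨⟨hAG, hAc⟩, hAr⟩, ?_⟩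
    -- `cl A = cl F = F`: `A ⊆ F` and `rk F = r = rk A`
    have hF' := mem_flatsQ.1 hF
    have hAF' : (A : Set α) ⊆ (F : Set α) := Finset.coe_subset.2 (hAF.trans Finset.inter_subset_left)
    have hclA : M.closure (A : Set α) = M.closure (F : Set α) :=
      (M.isRkFinite_of_finite (Finset.finite_toSet A)).closure_eq_closure_of_subset_of_eRk_ge_eRk hAF'
        (by rw [hF'.2.2, hAr])
    have hclF : M.closure (F : Set α) = (F : Set α) := hF'.2.1.closure
    apply Finset.coe_injective
    rw [coe_clF, hclA, hclF]

/-- **(R5b), the counting part**: `DF_t + C(n, t) ≥ #{|G ∖ S| < t} + i_t + Σ_{F ∈ flatsQ M (t−1)} #{A ⊆ F ∩ G : |A| = t, rk A = t − 1}`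
(`t ≥ 1`); the per-flat counts are bounded below by the flat sizes in sheet §55 (R5b). -/
theorem DFq_add_choose_ge_of_flats {G : Finset α} (hG : G ⊆ gr M) (q t : ℕ) (ht : 1 ≤ t) :
    ((Rq M G q).filter (fun S : Finset α => (G \ S).card < t)).card +
      ((Rq M G q).filter (fun S : Finset α => (G \ S).card = t)).card +
      ∑ F ∈ flatsQ M (t - 1), (((F ∩ G).powersetCard t).filter
        (fun A : Finset α => M.eRk (A : Set α) = ((t - 1 : ℕ) : ℕ∞))).card ≤
      DFq M G q t + G.card.choose t := by
  have h1 := DFq_ge_levels_add_rank_le (M := M) G q t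
  have h2 := card_rank_eq_spanning_ge (M := M) G q t (t - 1)
  have h3 := card_rank_eq_eq_sum_flats (M := M) hG t (t - 1)
  have h4 := card_level_eq_card_compl (M := M) G q t
  have h5 : ((coSpan M G q t).filter (fun A : Finset α => M.eRk (A : Set α) = ((t - 1 : ℕ) : ℕ∞))).card ≤
      ((coSpan M G q t).filter (fun A : Finset α => M.eRk (A : Set α) + 1 ≤ (t : ℕ∞))).card := by
    apply Finset.card_le_card
    intro A hA
    rw [Finset.mem_filter] at hA ⊢
    refine ⟨hA.1, ?_⟩
    rw [hA.2]
    have : ((t - 1 : ℕ) : ℕ∞) + 1 = ((t - 1 + 1 : ℕ) : ℕ∞) := by push_cast; rfl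
    rw [this]
    exact le_of_eq (by congr 1; omega)
  have hc : (coSpan M G q t).card ≤ G.card.choose t := by
    rw [← Finset.card_powersetCard]
    exact Finset.card_le_card (Finset.filter_subset _ _)
  omega

end PercRepro.Night4
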